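import Literature.Geometry.Riemannian.ConjugateRadiusBound
import Literature.Geometry.Riemannian.JacobiEnergyEstimates
import Literature.Geometry.Riemannian.RadialIsometryExp
import Literature.Geometry.Lorentzian.PPCurvatureSingularity
import HarnessLib

/-!
# Weinstein's criterion: a thin manifold around a geodesic ball with convex exit data has no conjugate cut vectors
(the assembly step of Weinstein 1968, abstract form)

Topic `Geometry/Riemannian`; sixth support file of the programme towards the named fact
`Weinstein1968_exists_metric_two_le_multiplicity_of_mem_cutLocus` (`WeinsteinCutLocus.lean`).
Weinstein's printed proof (A. Weinstein, Ann. of Math. 87 (1968) 29–41, via the review zbMATH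
0159.23902) constructs, on a compact manifold `M` of dimension `≥ 3`, a metric `g` and a point `p`
such that (1)–(3): the closed geodesic unit ball `D` of `p` is an embedded disk, `exp_p` being a
diffeomorphism of the closed unit ball of `T_pM` onto `D`, whose boundary `∂D` — a thin tube about an
`ε`-dense curve — has second fundamental form `> -Δ` and such that EVERY POINT OF `M` IS CLOSE TO `D`;
and then concludes, step (4): every cut vector `v` of `p` is short beyond `D`
(`|v| = d(p, exp_p v) ≤ 1 + θ`, `θ` the thinness), the minimizing geodesic `γ_v` runs outside `D`
after leaving it, where the metric is the unmodified one of bounded curvature, so by Warner's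
comparison theorem for focal points no `∂D`-focal point — hence no conjugate point of `p` — occurs
before the cut point: `C̃(p) ∩ Q̃(p) = ∅`.

This file proves STEP (4) AS A THEOREM ABOUT AN ARBITRARY COMPACT RIEMANNIAN MANIFOLD, isolating
exactly what the construction (1)–(3) has to deliver. For a smooth Riemannian metric `g` on a
compact connected Hausdorff manifold without boundary, a point `p` and reals `R > 0`, `θ ≥ 0`,
`λ ≥ 0`, `Λ`, assume

* (ball)  every `g_p`-unit vector `u` has `γ_u|[0, R]` minimizing (`t_cut ≥ R`: the closed `R`-ball
  about `p` is swept by minimizing radial segments) and `d(exp_p)_{R u}` injective (no conjugate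
  point ON the sphere of radius `R`);
* (exit)  **`λ`-convex exit data**: for every unit `u` and every `w ∈ T_pM`, the Jacobi field
  `S(t) = ∂_s|₀ γ_{u + s w}(t) = d(exp_p)_{t u}(t w)` of the geodesic variation satisfies
  `g(D_t S(R), S(R)) ≥ -λ g(S(R), S(R))` at the exit parameter `R` (for Weinstein: the shape
  operator of `∂D` towards the outer normal is `≥ -λ`, and `D_t S = S_{∂D}(S)` there);
* (curv)  `Rm(X, Y, Y, X) ≤ Λ (g(X,X) g(Y,Y) - g(X,Y)²)` at every point `x` with `d(p, x) ≥ R`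
  (sectional curvature `≤ Λ` OUTSIDE the open ball only — inside, where Weinstein modifies the
  metric, nothing is assumed);
* (thin)  every point `x` is within distance `θ` of a point `y` with `d(p, y) ≤ R`;
* (small) `λ θ + max Λ 0 · θ² < 1`.

Then (`forall_not_isConjugateVector_of_exitData`) **no tangent cut vector of `p` is conjugate**, and
hence (`two_le_minimalGeodesicMultiplicity_of_exitData`, through the bridge
`two_le_minimalGeodesicMultiplicity_of_forall_not_isConjugateVector` of
`WeinsteinCutLocusDichotomy.lean`) every point of `cutLocus g hg p` is joined to `p` by at least two
minimal geodesics — the conclusion of the named fact for this `(M, g, p)`.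

Finally `two_le_minimalGeodesicMultiplicity_of_radial` restates (ball) and (exit) through a
**radial isometry** `F : T_pM → M` on a ball of radius `r₁ > R` (`RadialIsometryExp.lean`:
`exp_p = F` there, radial segments minimize, `d(exp_p) = dF`): (ball) becomes automatic and (exit)
becomes the SCALAR inequality `-λ f(R) ≤ ½ f'(R)` for
`f(t) = g(dF_{tu}(t w), dF_{tu}(t w)) = |S(t)|²` (`g(D_tS, S) = ½ (|S|²)'` by metric
compatibility). This is the form in which Weinstein's construction — which builds the new metric
inside `D` together with its polar map `F` — is consumed.

## Proof (`not_isConjugateVector_of_exitData`, following Weinstein's step (4))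

Let `v ∈ TCL(p)`, `c = |v|_g > 0`, `u = v / c`. (ball) and the rescaling lemma give `R ≤ c`
(`γ_v = γ_u(c ·)` minimizes on `[0, R/c]`, and a cut vector minimizes on no `[0, s]`, `s > 1`);
(thin) at `x = exp_p v` and the triangle inequality give `c = d(p, exp_p v) ≤ R + θ`. Suppose
`d(exp_p)_v w = 0`, `w ≠ 0`. If `c = R` this contradicts (ball). If `c > R`, the Jacobi field
`S(t) = d(exp_p)_{tu}(t w/c)` along the unit-speed geodesic `γ_u` (`JacobiVariation.lean`:
smooth lifts, Jacobi equation `D_tD_tS + R(S, γ')γ' = 0`, `S(t) = d(exp_p)_{tu}(t w / c)`) has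
`S(c) = d(exp_p)_v(w) = 0` and `S(R) ≠ 0` by (ball). Along `γ_u|[R, c]` the distance to `p` is
`t ≥ R` (`γ_u|[0,c]` minimizes), so (curv) bounds the curvature there; shifting the parameter by `R`
(`IsGeodesicOn.comp_affine`, `covariantDerivAlong_comp_affine`) produces a Jacobi field `J` on
`[0, c - R]` with `λ`-convex initial data (exit), `J(c - R) = 0`, `c - R ≤ θ`, to which the energy
estimate `eq_zero_of_jacobi_of_neg_le_of_eq_zero` (`JacobiEnergyEstimates.lean`, Warner's focal
comparison in weak form) applies by (small): `J ≡ 0`, so `S(R) = J(0) = 0` — contradiction.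

No definitions, no named facts (D-0026); theorem-only file.

## References

* A. Weinstein, *The cut locus and conjugate locus of a Riemannian manifold*, Ann. of Math. 87
  (1968) 29–41, main theorem and step (4) of its proof [Weinstein1968]; zbMATH Zbl 0159.23902
  (review stating the four steps). Paper not held (acq-02556); the step is reconstructed from the
  review and standard comparison geometry.
* F. W. Warner, *Extension of the Rauch comparison theorem to submanifolds*, Trans. AMS 122 (1966)
  341–356 (focal comparison), cited through Weinstein; weak form = `JacobiEnergyEstimates.lean`.
* J. M. Lee, *Introduction to Riemannian Manifolds*, 2nd ed. (2018), Prop. 10.20 (conjugate =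
  critical), Thm. 10.1 (Jacobi fields of geodesic variations), pp. 307–310 (cut time, `TCL(p)`)
  [LeeRiemannianManifolds2018].
-/

noncomputable section

open Bundle Set Filter Function
open scoped Manifold ContDiff Topology

namespace Literature.Geometry.Riemannian

open Literature.Geometry.Lorentzian
open Literature.Geometry.Lorentzian.PseudoRiemannianMetric

variable {E : Type*} [NormedAddCommGroup E] [NormedSpace ℝ E] {H : Type*} [TopologicalSpace H]
  {I : ModelWithCorners ℝ E H} {M : Type*} [TopologicalSpace M] [ChartedSpace H M]
  [IsManifold I ∞ M] {n : ℕ∞ω} [FiniteDimensional ℝ E] [CompleteSpace E] [T2Space M]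
  [I.Boundaryless]
  {g : PseudoRiemannianMetric I n E (TangentSpace I : M → Type _)} [g.HasLeviCivita]

section Core

variable [Fact (1 ≤ n)]
  [CovariantDerivative.ContMDiffCovariantDerivative g.leviCivita 1]
  [CovariantDerivative.ContMDiffCovariantDerivative g.leviCivita ∞]

/-- **Weinstein's step (4), core form** (explicit completeness and regularity hypotheses; see
`forall_not_isConjugateVector_of_exitData` for the compact Riemannian statement and the module
docstring for the hypotheses (ball), (exit), (curv), (thin), (small) and the proof).
A tangent cut vector of `p` is not a conjugate vector. [cite: Weinstein1968, main theorem (step 4 of the proof)] -/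
theorem not_isConjugateVector_of_exitData (hg : g.IsRiemannian)
    (hcov₁ : g.leviCivita.IsLocallyContMDiff 1) (hc : IsGeodesicallyComplete g.leviCivita)
    {p : M} {R θ lam Λ : ℝ} (hR : 0 < R) (hθ : 0 ≤ θ) (hlam : 0 ≤ lam)
    (hmin : ∀ u : TangentSpace I p, g.val p u u = 1 → IsMinimizingUpTo g hg p u R)
    (hinj : ∀ u : TangentSpace I p, g.val p u u = 1 →
      Injective (mfderiv 𝓘(ℝ, E) I
        (fun w : E ↦ riemannianExpMap g p (show TangentSpace I p from w)) (R • (show E from u))))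
    (hexit : ∀ u w : TangentSpace I p, g.val p u u = 1 →
      -(lam * g.val (maximalGeodesic g.leviCivita p (u + (0 : ℝ) • w) R)
          (velocity I (fun s : ℝ ↦ maximalGeodesic g.leviCivita p (u + s • w) R) 0)
          (velocity I (fun s : ℝ ↦ maximalGeodesic g.leviCivita p (u + s • w) R) 0)) ≤
        g.val (maximalGeodesic g.leviCivita p (u + (0 : ℝ) • w) R)
          (covariantDerivAlong g.leviCivita
            (fun t ↦ maximalGeodesic g.leviCivita p (u + (0 : ℝ) • w) t)
            (fun t ↦ velocity I (fun s : ℝ ↦ maximalGeodesic g.leviCivita p (u + s • w) t) 0) R)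
          (velocity I (fun s : ℝ ↦ maximalGeodesic g.leviCivita p (u + s • w) R) 0))
    (hsec : ∀ x : M, ENNReal.ofReal R ≤ g.edist hg p x → ∀ X Y : TangentSpace I x,
      g.curvatureForm g.leviCivita x X Y Y X ≤
        Λ * (g.val x X X * g.val x Y Y - g.val x X Y ^ 2))
    (hthin : ∀ x : M, ∃ y : M, g.edist hg p y ≤ ENNReal.ofReal R ∧ g.edist hg x y ≤ ENNReal.ofReal θ)
    (hsmall : lam * θ + max Λ 0 * θ ^ 2 < 1)
    {v : TangentSpace I p} (hv : v ∈ tangentCutLocus g hg p) : ¬ IsConjugateVector g p v := by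
  intro hcv
  have hLC := isLeviCivita_leviCivita_holds (g := g)
  have htors : g.leviCivita.torsion = 0 := hLC.1
  have hcompat : g.IsCompatible g.leviCivita := hLC.2
  have h2 : (2 : ℕ∞ω) ≤ ∞ := WithTop.coe_le_coe.2 le_top
  obtain ⟨hv0, hvmin, hvmax⟩ := hv
  /- `c = |v|`, the unit vector `u = v / c` -/
  have hvv : 0 < g.val p v v := hg p v hv0
  set c : ℝ := Real.sqrt (g.val p v v) with hc_def
  have hcpos : 0 < c := Real.sqrt_pos.2 hvv
  have hcne : c ≠ 0 := hcpos.ne'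
  have hcsq : c * c = g.val p v v := Real.mul_self_sqrt hvv.le
  set u : TangentSpace I p := c⁻¹ • v with hu_def
  have hcu : c • u = v := by rw [hu_def, smul_inv_smul₀ hcne]
  have hu1 : g.val p u u = 1 := by
    have h1 : g.val p u u = c⁻¹ * c⁻¹ * g.val p v v := by
      rw [hu_def]
      simp only [map_smul, FunLike.coe_smul, Pi.smul_apply, smul_eq_mul]
      ring
    rw [h1, ← hcsq]
    field_simp
  /- `R ≤ c ≤ R + θ` -/
  have hminv : IsMinimizingUpTo g hg p v (R / c) := by
    rw [← hcu, isMinimizingUpTo_smul_iff hg hc p u hcpos (R / c),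
      show c * (R / c) = R by field_simp]
    exact hmin u hu1
  have hRc : R ≤ c := le_of_not_gt fun h ↦ hvmax (R / c) ((one_lt_div hcpos).2 h) hminv
  have hcle : c ≤ R + θ := by
    obtain ⟨y, hy1, hy2⟩ := hthin (riemannianExpMap g p v)
    have hd : g.edist hg p (riemannianExpMap g p v) = ENNReal.ofReal c :=
      edist_eq_of_isMinimizingUpTo hg hc hvmin
    have htri : g.edist hg p (riemannianExpMap g p v) ≤
        g.edist hg p y + g.edist hg y (riemannianExpMap g p v) := g.edist_triangle hg _ _ _
    rw [g.edist_comm hg y, hd] at htri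
    have h3 : ENNReal.ofReal c ≤ ENNReal.ofReal (R + θ) := by
      rw [ENNReal.ofReal_add hR.le hθ]
      exact htri.trans (add_le_add hy1 hy2)
    exact (ENNReal.ofReal_le_ofReal_iff (by linarith)).1 h3
  /- a vector in the kernel of `d(exp_p)_v` -/
  obtain ⟨-, hninj⟩ := hcv
  rw [injective_iff_map_eq_zero] at hninj
  push Not at hninj
  obtain ⟨w, hw, hw0⟩ := hninj
  rcases hRc.eq_or_lt with hcR | hcR
  · -- `c = R`: `v = R u` lies on the sphere, where `d(exp_p)` is injective
    have hvR : (show E from v) = R • (show E from u) := by rw [hcR]; exact hcu.symm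
    have hi := hinj u hu1
    rw [← hvR] at hi
    exact hw0 ((injective_iff_map_eq_zero _).1 hi w hw)
  /- `R < c`: the Jacobi field `S(t) = d(exp_p)_{tu}(t w₁)`, `w₁ = w / c`, along `γ_u` -/
  set w₁ : TangentSpace I p := c⁻¹ • (show TangentSpace I p from w) with hw₁_def
  have hcw : c • w₁ = w := by rw [hw₁_def, smul_inv_smul₀ hcne]
  have hw₁ : w₁ ≠ 0 := smul_ne_zero (inv_ne_zero hcne) hw0
  set X : ℝ → ℝ → M := fun t s ↦ maximalGeodesic g.leviCivita p (u + s • w₁) t with hX_def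
  have hXs : ContMDiff (𝓘(ℝ, ℝ).prod 𝓘(ℝ, ℝ)) I ∞ (uncurry X) :=
    contMDiff_uncurry_geodesicVariation hc p u w₁
  have hX2 : ∀ q : ℝ × ℝ, ContMDiffAt (𝓘(ℝ, ℝ).prod 𝓘(ℝ, ℝ)) I 2 (uncurry X) q :=
    fun q ↦ (hXs q).of_le h2
  set γ : ℝ → M := fun t ↦ X t 0 with hγ_def
  set S : Π t : ℝ, TangentSpace I (γ t) := fun t ↦ velocity I (X t) 0 with hS_def
  set T : Π t : ℝ, TangentSpace I (γ t) := fun t ↦ velocity I γ t with hT_def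
  set DS : Π t : ℝ, TangentSpace I (γ t) := fun t ↦ covariantDerivAlong g.leviCivita γ S t
    with hDS_def
  -- Jacobi equation
  have hjac : ∀ t₀ : ℝ, covariantDerivAlong g.leviCivita γ DS t₀ +
      g.leviCivita.curvature (γ t₀) (S t₀) (T t₀) (T t₀) = 0 :=
    fun t₀ ↦ jacobi_geodesicVariation hcov₁ htors hc p u w₁ 0 t₀
  -- differentiability of the lifts of `S` and `DS`
  have hSl : ContMDiff 𝓘(ℝ, ℝ) I.tangent ∞
      (fun t ↦ (TotalSpace.mk' E (γ t) (S t) : TangentBundle I M)) :=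
    contMDiff_lift_velocity_geodesicVariation hc p u w₁ 0
  have hS : ∀ t, MDifferentiableAt 𝓘(ℝ, ℝ) I.tangent
      (fun t ↦ (TotalSpace.mk' E (γ t) (S t) : TangentBundle I M)) t :=
    fun t ↦ (hSl t).mdifferentiableAt (by simp)
  have hT2 : ∀ q : ℝ × ℝ, ContMDiffAt (𝓘(ℝ, ℝ).prod 𝓘(ℝ, ℝ)) I.tangent 2
      (fun q : ℝ × ℝ ↦ (TotalSpace.mk' E (X q.1 q.2) (velocity I (fun t' ↦ X t' q.2) q.1) :
        TangentBundle I M)) q :=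
    fun q ↦ ((contMDiff_tangentLift_geodesicVariation hc p u w₁) q).of_le h2
  have hsymm : ∀ t, covariantDerivAlong g.leviCivita γ S t =
      covariantDerivAlong g.leviCivita (X t) (fun s ↦ velocity I (fun t' ↦ X t' s) t) 0 :=
    fun t ↦ covariantDerivAlong_velocity_comm g.leviCivita htors (hX2 (t, 0))
  have hDsT : ∀ t, MDifferentiableAt 𝓘(ℝ, ℝ) I.tangent (fun t' ↦ (TotalSpace.mk' E (X t' 0)
      (covariantDerivAlong g.leviCivita (X t') (fun s ↦ velocity I (fun t'' ↦ X t'' s) t') 0) :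
        TangentBundle I M)) t :=
    fun t ↦ mdifferentiableAt_lift_covariantDerivAlong_curry_right g.leviCivita hcov₁
      (hX2 (t, 0)) (hT2 (t, 0))
  have hDS : ∀ t, MDifferentiableAt 𝓘(ℝ, ℝ) I.tangent
      (fun t' ↦ (TotalSpace.mk' E (γ t') (DS t') : TangentBundle I M)) t := by
    intro t
    have heq : (fun t' ↦ (TotalSpace.mk' E (γ t') (DS t') : TangentBundle I M)) =
        fun t' ↦ (TotalSpace.mk' E (X t' 0) (covariantDerivAlong g.leviCivita (X t')
          (fun s ↦ velocity I (fun t'' ↦ X t'' s) t') 0) : TangentBundle I M) := by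
      funext t'
      show (TotalSpace.mk' E (X t' 0) (covariantDerivAlong g.leviCivita γ S t') :
          TangentBundle I M) = _
      rw [TotalSpace.mk_inj]
      exact hsymm t'
    rw [heq]
    exact hDsT t
  -- `γ = γ_u` is a unit-speed geodesic
  obtain ⟨-, hgeo, hγ0, hγu⟩ := maximalGeodesic_of_isGeodesicallyComplete hc p (u + (0 : ℝ) • w₁)
  have hTT : ∀ t, g.val (γ t) (T t) (T t) = 1 := by
    intro t
    have h := g.val_velocity_eq_of_isGeodesicOn_of_isCompatible hcompat isOpen_univ
      ordConnected_univ (hgeo.isGeodesicOn univ) (mem_univ t) (mem_univ 0)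
    have h0 : velocity I (maximalGeodesic g.leviCivita p (u + (0 : ℝ) • w₁)) 0 = u := by
      rw [hγu, zero_smul, add_zero]
    have hp0 : maximalGeodesic g.leviCivita p (u + (0 : ℝ) • w₁) 0 = p := hγ0
    show g.val (maximalGeodesic g.leviCivita p (u + (0 : ℝ) • w₁) t)
      (velocity I (maximalGeodesic g.leviCivita p (u + (0 : ℝ) • w₁)) t)
      (velocity I (maximalGeodesic g.leviCivita p (u + (0 : ℝ) • w₁)) t) = 1
    rw [h]
    have key : ∀ (y : M) (hy : y = p) (u' : TangentSpace I y), HEq u' u → g.val y u' u' = 1 := by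
      intro y hy u' hu'
      subst hy
      have : u' = u := eq_of_heq hu'
      rw [this, hu1]
    exact key _ hp0 _ (heq_of_eq h0)
  -- `S(c) = d(exp_p)_v(w) = 0`
  have hSc : S c = 0 := by
    have h := velocity_geodesicVariation_eq_mfderiv_expMap hc p u w₁ c
    show velocity I (fun s : ℝ ↦ maximalGeodesic g.leviCivita p (u + s • w₁) c) 0 = 0
    rw [h]
    have e1 : c • (show E from u) = (show E from v) := hcu
    have e2 : c • (show E from w₁) = w := hcw
    rw [e1, e2]
    exact hw
  -- `S(R) ≠ 0`: `d(exp_p)_{Ru}` is injective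
  have hSR : S R ≠ 0 := by
    intro h0
    have h := velocity_geodesicVariation_eq_mfderiv_expMap hc p u w₁ R
    have h' : mfderiv 𝓘(ℝ, E) I
        (fun w : E ↦ riemannianExpMap g p (show TangentSpace I p from w)) (R • (show E from u))
        (R • (show E from w₁)) = 0 := by
      rw [riemannianExpMap_eq (g := g)] -- unfold `riemannianExpMap` to `expMap`
      exact h.symm.trans h0
    have h3 : R • (show E from w₁) = 0 := (injective_iff_map_eq_zero _).1 (hinj u hu1) _ h'
    exact hw₁ ((smul_eq_zero.1 h3).resolve_left hR.ne')
  -- distances along `γ`: `d(p, γ t) = t` on `[0, c]`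
  have hγt : ∀ t, γ t = riemannianExpMap g p ((c⁻¹ * t) • v) := by
    intro t
    show maximalGeodesic g.leviCivita p (u + (0 : ℝ) • w₁) t = _
    rw [zero_smul, add_zero]
    show maximalGeodesic g.leviCivita p (c⁻¹ • v) t = riemannianExpMap g p ((c⁻¹ * t) • v)
    rw [maximalGeodesic_smul hc p v c⁻¹ t, riemannianExpMap_eq, expMap_smul hc p v (c⁻¹ * t)]
  have hdist : ∀ t ∈ Icc (0 : ℝ) c, g.edist hg p (γ t) = ENNReal.ofReal t := by
    intro t ht
    have hmem : c⁻¹ * t ∈ Icc (0 : ℝ) 1 :=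
      ⟨mul_nonneg (inv_nonneg.2 hcpos.le) ht.1, by rw [inv_mul_le_iff₀ hcpos, mul_one]; exact ht.2⟩
    rw [hγt t, edist_self_expMap_smul_of_isMinimizingUpTo hg hc hvmin hmem, ← hc_def]
    congr 1
    field_simp
  have hsecγ : ∀ t ∈ Icc R c, ∀ X' Y' : TangentSpace I (γ t),
      g.curvatureForm g.leviCivita (γ t) X' Y' Y' X' ≤
        Λ * (g.val (γ t) X' X' * g.val (γ t) Y' Y' - g.val (γ t) X' Y' ^ 2) := by
    intro t ht X' Y'
    refine hsec (γ t) ?_ X' Y'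
    rw [hdist t ⟨hR.le.trans ht.1, ht.2⟩]
    exact ENNReal.ofReal_le_ofReal ht.1
  /- the shifted Jacobi field `J(τ) = S(τ + R)` along `γ' (τ) = γ (τ + R)` -/
  set t₁ : ℝ := c - R with ht₁_def
  have ht₁ : 0 < t₁ := sub_pos.2 hcR
  have ht₁θ : t₁ ≤ θ := by rw [ht₁_def]; linarith
  set γ' : ℝ → M := fun τ ↦ γ (1 * τ + R) with hγ'_def
  set J : Π τ : ℝ, TangentSpace I (γ' τ) := fun τ ↦ S (1 * τ + R) with hJ_def
  have hgeo' : IsGeodesicOn g.leviCivita γ' univ := by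
    have h := IsGeodesicOn.comp_affine_holds (cov := g.leviCivita) (hgeo.isGeodesicOn univ) 1 R
    rwa [preimage_univ] at h
  have hJ' : ∀ τ, MDifferentiableAt 𝓘(ℝ, ℝ) I.tangent
      (fun τ ↦ (TotalSpace.mk' E (γ' τ) (J τ) : TangentBundle I M)) τ :=
    fun τ ↦ mdifferentiableAt_lift_comp_affine (γ := γ) (W := S) 1 R (hS (1 * τ + R))
  have hDJ_eq : ∀ τ, covariantDerivAlong g.leviCivita γ' J τ = DS (1 * τ + R) := by
    intro τ
    have h := covariantDerivAlong_comp_affine (cov := g.leviCivita) γ S 1 R τ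
    rw [one_smul] at h
    exact h
  have hDJ_fun : (fun τ ↦ covariantDerivAlong g.leviCivita γ' J τ) = fun τ ↦ DS (1 * τ + R) :=
    funext hDJ_eq
  have hDJ' : ∀ τ, MDifferentiableAt 𝓘(ℝ, ℝ) I.tangent
      (fun τ ↦ (TotalSpace.mk' E (γ' τ) (covariantDerivAlong g.leviCivita γ' J τ) :
        TangentBundle I M)) τ := by
    intro τ
    have h := mdifferentiableAt_lift_comp_affine (γ := γ) (W := DS) 1 R (hDS (1 * τ + R))
    have heq : (fun τ ↦ (TotalSpace.mk' E (γ' τ) (covariantDerivAlong g.leviCivita γ' J τ) :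
        TangentBundle I M)) = fun τ ↦ (TotalSpace.mk' E (γ (1 * τ + R)) (DS (1 * τ + R)) :
          TangentBundle I M) := by
      funext τ
      rw [hDJ_eq τ]
    rw [heq]
    exact h
  have hjac' : ∀ τ, covariantDerivAlong g.leviCivita γ'
        (fun τ ↦ covariantDerivAlong g.leviCivita γ' J τ) τ +
      g.leviCivita.curvature (γ' τ) (J τ) (velocity I γ' τ) (velocity I γ' τ) = 0 := by
    intro τ
    rw [hDJ_fun]
    have h1 : covariantDerivAlong g.leviCivita γ' (fun τ ↦ DS (1 * τ + R)) τ =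
        covariantDerivAlong g.leviCivita γ DS (1 * τ + R) := by
      have h := covariantDerivAlong_comp_affine (cov := g.leviCivita) γ DS 1 R τ
      rw [one_smul] at h
      exact h
    have hv1 : velocity I γ' τ = T (1 * τ + R) := by
      have h := velocity_comp_affine (I := I) γ 1 R τ
      rw [one_smul] at h
      exact h
    rw [h1, hv1]
    exact hjac (1 * τ + R)
  have hvel0 : velocity I γ' 0 = T (1 * 0 + R) := by
    have h := velocity_comp_affine (I := I) γ 1 R 0
    rw [one_smul] at h
    exact h
  have hspeed : g.val (γ' 0) (velocity I γ' 0) (velocity I γ' 0) = 1 := by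
    rw [hvel0]
    exact hTT (1 * 0 + R)
  -- initial data, terminal zero, smallness
  have h0' : -(lam * g.val (γ' 0) (J 0) (J 0)) ≤
      g.val (γ' 0) (covariantDerivAlong g.leviCivita γ' J 0) (J 0) := by
    rw [hDJ_eq 0]
    have key : ∀ t : ℝ, t = R → -(lam * g.val (γ t) (S t) (S t)) ≤ g.val (γ t) (DS t) (S t) := by
      rintro t rfl
      exact hexit u w₁ hu1
    exact key (1 * 0 + R) (by ring)
  have hJt₁ : J t₁ = 0 := by
    have key : ∀ t : ℝ, t = c → S t = 0 := by
      rintro t rfl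
      exact hSc
    exact key (1 * t₁ + R) (by rw [ht₁_def]; ring)
  have hshort : lam * t₁ +
      max Λ 0 * g.val (γ' 0) (velocity I γ' 0) (velocity I γ' 0) * t₁ ^ 2 < 1 := by
    rw [hspeed, mul_one]
    have h1 : lam * t₁ ≤ lam * θ := mul_le_mul_of_nonneg_left ht₁θ hlam
    have h2' : max Λ 0 * t₁ ^ 2 ≤ max Λ 0 * θ ^ 2 :=
      mul_le_mul_of_nonneg_left (pow_le_pow_left₀ ht₁.le ht₁θ 2) (le_max_right _ _)
    linarith
  have hsec' : ∀ τ ∈ Icc (0 : ℝ) t₁, ∀ X' Y' : TangentSpace I (γ' τ),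
      g.curvatureForm g.leviCivita (γ' τ) X' Y' Y' X' ≤
        Λ * (g.val (γ' τ) X' X' * g.val (γ' τ) Y' Y' - g.val (γ' τ) X' Y' ^ 2) := by
    intro τ hτ X' Y'
    have hmem : 1 * τ + R ∈ Icc R c := by
      rw [ht₁_def] at hτ
      constructor <;> linarith [hτ.1, hτ.2]
    exact hsecγ (1 * τ + R) hmem X' Y'
  -- the energy estimate: `J ≡ 0` on `[0, t₁]`, in particular `S(R) = J(0) = 0`
  have hzero := eq_zero_of_jacobi_of_neg_le_of_eq_zero hg hcompat hgeo' hJ' hDJ' hjac' ht₁ hsec'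
    hlam h0' hJt₁ hshort 0 (left_mem_Icc.2 ht₁.le)
  have key : ∀ t : ℝ, t = R → S t = 0 → False := by
    rintro t rfl h
    exact hSR h
  exact key (1 * 0 + R) (by ring) hzero

end Core

/-! ### The criterion on a compact manifold, and the multiplicity form -/

section Compact

omit [CompleteSpace E]

/-- **Weinstein's criterion (step (4) of Weinstein 1968, abstract form): on a compact manifold
which is thin around a closed geodesic ball with `λ`-convex exit data and bounded curvature
outside, no cut vector of the centre is conjugate.** Let `g` be a smooth (`∞ ≤ n`) Riemannian
metric on a compact connected Hausdorff manifold without boundary, `p ∈ M`, `0 < R`, `0 ≤ θ`,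
`0 ≤ λ`, `Λ ∈ ℝ`, such that: (ball) for every `g_p`-unit vector `u`, `γ_u|[0,R]` is minimizing and
`d(exp_p)_{Ru}` is injective; (exit) for every unit `u` and every `w`, the Jacobi field
`S(t) = ∂_s|₀ γ_{u+sw}(t)` satisfies `-λ g(S(R),S(R)) ≤ g(D_tS(R), S(R))`; (curv)
`Rm(X,Y,Y,X) ≤ Λ (g(X,X)g(Y,Y) - g(X,Y)²)` at every `x` with `d(p, x) ≥ R`; (thin) every `x ∈ M`
has some `y` with `d(p, y) ≤ R` and `d(x, y) ≤ θ`; (small) `λ θ + max Λ 0 · θ² < 1`. Then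
`¬ IsConjugateVector g p v` for every `v ∈ tangentCutLocus g hg p` — Weinstein's conclusion
`C̃(p) ∩ Q̃(p) = ∅` for this metric and point. [cite: Weinstein1968, main theorem (step 4 of the proof)] -/
theorem forall_not_isConjugateVector_of_exitData [CompactSpace M] [ConnectedSpace M]
    (hn : (∞ : ℕ∞ω) ≤ n) (hg : g.IsRiemannian)
    {p : M} {R θ lam Λ : ℝ} (hR : 0 < R) (hθ : 0 ≤ θ) (hlam : 0 ≤ lam)
    (hmin : ∀ u : TangentSpace I p, g.val p u u = 1 → IsMinimizingUpTo g hg p u R)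
    (hinj : ∀ u : TangentSpace I p, g.val p u u = 1 →
      Injective (mfderiv 𝓘(ℝ, E) I
        (fun w : E ↦ riemannianExpMap g p (show TangentSpace I p from w)) (R • (show E from u))))
    (hexit : ∀ u w : TangentSpace I p, g.val p u u = 1 →
      -(lam * g.val (maximalGeodesic g.leviCivita p (u + (0 : ℝ) • w) R)
          (velocity I (fun s : ℝ ↦ maximalGeodesic g.leviCivita p (u + s • w) R) 0)
          (velocity I (fun s : ℝ ↦ maximalGeodesic g.leviCivita p (u + s • w) R) 0)) ≤
        g.val (maximalGeodesic g.leviCivita p (u + (0 : ℝ) • w) R)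
          (covariantDerivAlong g.leviCivita
            (fun t ↦ maximalGeodesic g.leviCivita p (u + (0 : ℝ) • w) t)
            (fun t ↦ velocity I (fun s : ℝ ↦ maximalGeodesic g.leviCivita p (u + s • w) t) 0) R)
          (velocity I (fun s : ℝ ↦ maximalGeodesic g.leviCivita p (u + s • w) R) 0))
    (hsec : ∀ x : M, ENNReal.ofReal R ≤ g.edist hg p x → ∀ X Y : TangentSpace I x,
      g.curvatureForm g.leviCivita x X Y Y X ≤
        Λ * (g.val x X X * g.val x Y Y - g.val x X Y ^ 2))
    (hthin : ∀ x : M, ∃ y : M, g.edist hg p y ≤ ENNReal.ofReal R ∧ g.edist hg x y ≤ ENNReal.ofReal θ)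
    (hsmall : lam * θ + max Λ 0 * θ ^ 2 < 1) :
    ∀ v ∈ tangentCutLocus g hg p, ¬ IsConjugateVector g p v := by
  haveI : CompleteSpace E := FiniteDimensional.complete ℝ E
  haveI := fact_one_le_of_infty_le hn
  haveI : CovariantDerivative.ContMDiffCovariantDerivative g.leviCivita ∞ :=
    contMDiffCovariantDerivative_leviCivita_infty g hn
  have hcov₁ : g.leviCivita.IsLocallyContMDiff 1 :=
    g.isLocallyContMDiff_leviCivita_holds 1 (le_trans (by exact_mod_cast le_top) hn)
  haveI : CovariantDerivative.ContMDiffCovariantDerivative g.leviCivita 1 :=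
    ⟨g.isLocallyContMDiff_leviCivita_holds 1 (le_trans (by exact_mod_cast le_top) hn) univ
      isOpen_univ⟩
  have hc : IsGeodesicallyComplete g.leviCivita := hopfRinow_compact_geodesicallyComplete hn hg
  intro v hv
  exact not_isConjugateVector_of_exitData hg hcov₁ hc hR hθ hlam hmin hinj hexit hsec hthin hsmall
    hv

/-- **Weinstein's step (4) with the bridge to the multiplicity form**: under the hypotheses of
`forall_not_isConjugateVector_of_exitData`, every point of the metric cut locus of `p` is joined to
`p` by at least two distinct minimal geodesics, `2 ≤ minimalGeodesicMultiplicity g hg p q` for all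
`q ∈ cutLocus g hg p` (`two_le_minimalGeodesicMultiplicity_of_forall_not_isConjugateVector`: Chavel's
dichotomy at a non-conjugate cut vector). This is the conclusion of the named fact
`Weinstein1968_exists_metric_two_le_multiplicity_of_mem_cutLocus` for the given `(M, g, p)`; what
remains of Weinstein's theorem is the CONSTRUCTION, on every compact manifold of dimension `≥ 3`,
of a metric and a point satisfying (ball), (exit), (curv), (thin), (small).
[cite: Weinstein1968, main theorem] [cite: Chavel2006, §III.2 item 3 (PDF p. 93)] -/
theorem two_le_minimalGeodesicMultiplicity_of_exitData [CompactSpace M] [ConnectedSpace M]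
    (hn : (∞ : ℕ∞ω) ≤ n) (hg : g.IsRiemannian)
    {p : M} {R θ lam Λ : ℝ} (hR : 0 < R) (hθ : 0 ≤ θ) (hlam : 0 ≤ lam)
    (hmin : ∀ u : TangentSpace I p, g.val p u u = 1 → IsMinimizingUpTo g hg p u R)
    (hinj : ∀ u : TangentSpace I p, g.val p u u = 1 →
      Injective (mfderiv 𝓘(ℝ, E) I
        (fun w : E ↦ riemannianExpMap g p (show TangentSpace I p from w)) (R • (show E from u))))
    (hexit : ∀ u w : TangentSpace I p, g.val p u u = 1 →
      -(lam * g.val (maximalGeodesic g.leviCivita p (u + (0 : ℝ) • w) R)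
          (velocity I (fun s : ℝ ↦ maximalGeodesic g.leviCivita p (u + s • w) R) 0)
          (velocity I (fun s : ℝ ↦ maximalGeodesic g.leviCivita p (u + s • w) R) 0)) ≤
        g.val (maximalGeodesic g.leviCivita p (u + (0 : ℝ) • w) R)
          (covariantDerivAlong g.leviCivita
            (fun t ↦ maximalGeodesic g.leviCivita p (u + (0 : ℝ) • w) t)
            (fun t ↦ velocity I (fun s : ℝ ↦ maximalGeodesic g.leviCivita p (u + s • w) t) 0) R)
          (velocity I (fun s : ℝ ↦ maximalGeodesic g.leviCivita p (u + s • w) R) 0))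
    (hsec : ∀ x : M, ENNReal.ofReal R ≤ g.edist hg p x → ∀ X Y : TangentSpace I x,
      g.curvatureForm g.leviCivita x X Y Y X ≤
        Λ * (g.val x X X * g.val x Y Y - g.val x X Y ^ 2))
    (hthin : ∀ x : M, ∃ y : M, g.edist hg p y ≤ ENNReal.ofReal R ∧ g.edist hg x y ≤ ENNReal.ofReal θ)
    (hsmall : lam * θ + max Λ 0 * θ ^ 2 < 1) :
    ∀ q ∈ cutLocus g hg p, 2 ≤ minimalGeodesicMultiplicity g hg p q := by
  haveI : CompleteSpace E := FiniteDimensional.complete ℝ E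
  haveI := fact_one_le_of_infty_le hn
  haveI : CovariantDerivative.ContMDiffCovariantDerivative g.leviCivita 1 :=
    ⟨g.isLocallyContMDiff_leviCivita_holds 1 (le_trans (by exact_mod_cast le_top) hn) univ
      isOpen_univ⟩
  exact two_le_minimalGeodesicMultiplicity_of_forall_not_isConjugateVector hn hg
    (forall_not_isConjugateVector_of_exitData hn hg hR hθ hlam hmin hinj hexit hsec hthin hsmall)

end Compact

/-! ### The criterion through a radial isometry -/

section Radial

omit [CompleteSpace E]

omit [FiniteDimensional ℝ E] [T2Space M] [I.Boundaryless] [g.HasLeviCivita] in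
/-- Transport of a value of `g` along an equality of base points (vectors read in `E`). [folklore] -/
private theorem val_eq_of_eq_basePoint {x y : M} (h : x = y) (a b : E) :
    g.val x a b = g.val y a b := by
  subst h
  rfl

/-- **Weinstein's step (4) fed by a radial isometry** (the form consumed by the construction). Let
`g` be a smooth Riemannian metric on a compact connected Hausdorff manifold without boundary, `p`,
`0 < R < r₁`, `0 ≤ θ`, `0 ≤ λ`, `Λ`, and `F : E = T_pM → M` a radial isometry on the open
`g_p`-ball of radius `r₁` (hypotheses of `riemannianExpMap_eq_of_radial`: `C^∞`, `F 0 = p`,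
`dF_0 = id`, injective with injective differentials, Gauss identities). Assume
(exit') for every `g_p`-unit `u` and every `w`, with `f(t) = g(dF_{tu}(t w), dF_{tu}(t w))`:
`-λ f(R) ≤ ½ f'(R)`; (curv) sectional curvature `≤ Λ` at the points `x` with `d(p, x) ≥ R`;
(thin) every `x` is within `θ` of a point `y` with `d(p, y) ≤ R`; (small) `λ θ + max Λ 0 · θ² < 1`.
Then every `q ∈ cutLocus g hg p` has `2 ≤ minimalGeodesicMultiplicity g hg p q`. Proof: by
`RadialIsometryExp.lean`, `exp_p = F` on the ball, radial segments minimize (so (ball) of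
`two_le_minimalGeodesicMultiplicity_of_exitData` holds at radius `R < r₁`) and
`d(exp_p)_{tu} = dF_{tu}`, so the Jacobi field `S(t) = ∂_s|₀ γ_{u+sw}(t) = d(exp_p)_{tu}(t w)` has
`|S(t)|² = f(t)` near `t = R` and `g(D_tS(R), S(R)) = ½ f'(R)` (metric compatibility,
`hasDerivAt_val_apply_along`), which turns (exit') into (exit).
[cite: Weinstein1968, main theorem (steps 3–4 of the proof)] -/
theorem two_le_minimalGeodesicMultiplicity_of_radial [CompactSpace M] [ConnectedSpace M]
    (hn : (∞ : ℕ∞ω) ≤ n) (hg : g.IsRiemannian)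
    {p : M} {F : E → M} {r₁ R θ lam Λ : ℝ} (hR : 0 < R) (hRr : R < r₁) (hθ : 0 ≤ θ)
    (hlam : 0 ≤ lam)
    (hFs : ContMDiffOn 𝓘(ℝ, E) I ∞ F {v : E | g.val p v v < r₁ ^ 2})
    (hF0 : F 0 = p)
    (hdF0 : ∀ w : E, mfderiv 𝓘(ℝ, E) I F 0 w = w)
    (hinj : InjOn F {v : E | g.val p v v < r₁ ^ 2})
    (hdF : ∀ v : E, g.val p v v < r₁ ^ 2 → Injective (mfderiv 𝓘(ℝ, E) I F v))
    (hrad : ∀ v : E, g.val p v v < r₁ ^ 2 →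
      g.val (F v) (mfderiv 𝓘(ℝ, E) I F v v) (mfderiv 𝓘(ℝ, E) I F v v) = g.val p v v)
    (hgauss : ∀ v β : E, g.val p v v < r₁ ^ 2 → g.val p v β = 0 →
      g.val (F v) (mfderiv 𝓘(ℝ, E) I F v v) (mfderiv 𝓘(ℝ, E) I F v β) = 0)
    (hexit : ∀ u w : E, g.val p u u = 1 →
      -(lam * g.val (F (R • u)) (mfderiv 𝓘(ℝ, E) I F (R • u) (R • w))
          (mfderiv 𝓘(ℝ, E) I F (R • u) (R • w))) ≤
        (1 / 2) * deriv (fun t : ℝ ↦ g.val (F (t • u)) (mfderiv 𝓘(ℝ, E) I F (t • u) (t • w))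
          (mfderiv 𝓘(ℝ, E) I F (t • u) (t • w))) R)
    (hsec : ∀ x : M, ENNReal.ofReal R ≤ g.edist hg p x → ∀ X Y : TangentSpace I x,
      g.curvatureForm g.leviCivita x X Y Y X ≤
        Λ * (g.val x X X * g.val x Y Y - g.val x X Y ^ 2))
    (hthin : ∀ x : M, ∃ y : M, g.edist hg p y ≤ ENNReal.ofReal R ∧ g.edist hg x y ≤ ENNReal.ofReal θ)
    (hsmall : lam * θ + max Λ 0 * θ ^ 2 < 1) :
    ∀ q ∈ cutLocus g hg p, 2 ≤ minimalGeodesicMultiplicity g hg p q := by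
  haveI : CompleteSpace E := FiniteDimensional.complete ℝ E
  haveI := fact_one_le_of_infty_le hn
  haveI : CovariantDerivative.ContMDiffCovariantDerivative g.leviCivita ∞ :=
    contMDiffCovariantDerivative_leviCivita_infty g hn
  have hcov₁ : g.leviCivita.IsLocallyContMDiff 1 :=
    g.isLocallyContMDiff_leviCivita_holds 1 (le_trans (by exact_mod_cast le_top) hn)
  haveI : CovariantDerivative.ContMDiffCovariantDerivative g.leviCivita 1 :=
    ⟨g.isLocallyContMDiff_leviCivita_holds 1 (le_trans (by exact_mod_cast le_top) hn) univ
      isOpen_univ⟩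
  have hc : IsGeodesicallyComplete g.leviCivita := hopfRinow_compact_geodesicallyComplete hn hg
  have hLC := isLeviCivita_leviCivita_holds (g := g)
  have htors : g.leviCivita.torsion = 0 := hLC.1
  have hcompat : g.IsCompatible g.leviCivita := hLC.2
  have h2 : (2 : ℕ∞ω) ≤ (∞ : ℕ∞ω) := WithTop.coe_le_coe.2 le_top
  have hr₁ : 0 < r₁ := hR.trans hRr
  set G : E →L[ℝ] E →L[ℝ] ℝ := g.val p with hG
  -- the ball membership of `t u` for a unit `u`
  have hGtu : ∀ u : E, G u u = 1 → ∀ t : ℝ, G (t • u) (t • u) = t ^ 2 := fun u hu t ↦ by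
    simp only [map_smul, FunLike.coe_smul, Pi.smul_apply, smul_eq_mul, hu]
    ring
  have hBt : ∀ u : E, G u u = 1 → ∀ t : ℝ, |t| < r₁ → G (t • u) (t • u) < r₁ ^ 2 := fun u hu t ht ↦ by
    rw [hGtu u hu]
    exact sq_lt_sq' (by linarith [abs_lt.1 ht |>.1]) (abs_lt.1 ht).2
  have hRabs : |R| < r₁ := by rw [abs_of_pos hR]; exact hRr
  refine two_le_minimalGeodesicMultiplicity_of_exitData hn hg hR hθ hlam (fun u hu ↦ ?_)
    (fun u hu ↦ ?_) (fun u w hu ↦ ?_) hsec hthin hsmall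
  · -- (ball), minimality: `γ_{Ru}|[0,1]` minimizes, i.e. `γ_u|[0,R]`
    have h := isMinimizingUpTo_of_radial hn hg hc hr₁ hFs hF0 hdF0 hinj hdF hrad hgauss
      (v := R • (show E from u)) (hBt u hu R hRabs)
    have h' := (isMinimizingUpTo_smul_iff hg hc p u hR 1).1 h
    rwa [mul_one] at h'
  · -- (ball), no conjugate vector on the sphere: `d(exp_p)_{Ru} = dF_{Ru}` is injective
    rw [mfderiv_riemannianExpMap_eq_of_radial hn hg hc hr₁ hFs hF0 hdF0 hinj hdF hrad hgauss
      (hBt u hu R hRabs)]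
    exact hdF _ (hBt u hu R hRabs)
  · -- (exit): the Jacobi field `S(t) = d(exp_p)_{tu}(tw) = dF_{tu}(tw)` and `g(D_tS,S) = f'/2`
    set X : ℝ → ℝ → M := fun t s ↦ maximalGeodesic g.leviCivita p (u + s • w) t with hX_def
    have hXs : ContMDiff (𝓘(ℝ, ℝ).prod 𝓘(ℝ, ℝ)) I ∞ (uncurry X) :=
      contMDiff_uncurry_geodesicVariation hc p u w
    have hX2 : ∀ q : ℝ × ℝ, ContMDiffAt (𝓘(ℝ, ℝ).prod 𝓘(ℝ, ℝ)) I 2 (uncurry X) q :=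
      fun q ↦ (hXs q).of_le h2
    set γ : ℝ → M := fun t ↦ X t 0 with hγ_def
    set S : Π t : ℝ, TangentSpace I (γ t) := fun t ↦ velocity I (X t) 0 with hS_def
    set DS : Π t : ℝ, TangentSpace I (γ t) := fun t ↦ covariantDerivAlong g.leviCivita γ S t
      with hDS_def
    have hSl : ContMDiff 𝓘(ℝ, ℝ) I.tangent ∞
        (fun t ↦ (TotalSpace.mk' E (γ t) (S t) : TangentBundle I M)) :=
      contMDiff_lift_velocity_geodesicVariation hc p u w 0
    have hS : ∀ t, MDifferentiableAt 𝓘(ℝ, ℝ) I.tangent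
        (fun t ↦ (TotalSpace.mk' E (γ t) (S t) : TangentBundle I M)) t :=
      fun t ↦ (hSl t).mdifferentiableAt (by simp)
    have hT2 : ∀ q : ℝ × ℝ, ContMDiffAt (𝓘(ℝ, ℝ).prod 𝓘(ℝ, ℝ)) I.tangent 2
        (fun q : ℝ × ℝ ↦ (TotalSpace.mk' E (X q.1 q.2) (velocity I (fun t' ↦ X t' q.2) q.1) :
          TangentBundle I M)) q :=
      fun q ↦ ((contMDiff_tangentLift_geodesicVariation hc p u w) q).of_le h2
    have hsymm : ∀ t, covariantDerivAlong g.leviCivita γ S t =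
        covariantDerivAlong g.leviCivita (X t) (fun s ↦ velocity I (fun t' ↦ X t' s) t) 0 :=
      fun t ↦ covariantDerivAlong_velocity_comm g.leviCivita htors (hX2 (t, 0))
    have hDsT : ∀ t, MDifferentiableAt 𝓘(ℝ, ℝ) I.tangent (fun t' ↦ (TotalSpace.mk' E (X t' 0)
        (covariantDerivAlong g.leviCivita (X t') (fun s ↦ velocity I (fun t'' ↦ X t'' s) t') 0) :
          TangentBundle I M)) t :=
      fun t ↦ mdifferentiableAt_lift_covariantDerivAlong_curry_right g.leviCivita hcov₁
        (hX2 (t, 0)) (hT2 (t, 0))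
    have hDS : ∀ t, MDifferentiableAt 𝓘(ℝ, ℝ) I.tangent
        (fun t' ↦ (TotalSpace.mk' E (γ t') (DS t') : TangentBundle I M)) t := by
      intro t
      have heq : (fun t' ↦ (TotalSpace.mk' E (γ t') (DS t') : TangentBundle I M)) =
          fun t' ↦ (TotalSpace.mk' E (X t' 0) (covariantDerivAlong g.leviCivita (X t')
            (fun s ↦ velocity I (fun t'' ↦ X t'' s) t') 0) : TangentBundle I M) := by
        funext t'
        show (TotalSpace.mk' E (X t' 0) (covariantDerivAlong g.leviCivita γ S t') :
            TangentBundle I M) = _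
        rw [TotalSpace.mk_inj]
        exact hsymm t'
      rw [heq]
      exact hDsT t
    -- the scalar functions `|S|²` and `g(D_tS, S)`
    set fF : ℝ → ℝ := fun t ↦ g.val (γ t) (S t) (S t) with hfF
    set aF : ℝ → ℝ := fun t ↦ g.val (γ t) (DS t) (S t) with haF
    have hf : ∀ t, HasDerivAt fF (2 * aF t) t := fun t ↦ by
      have h := hasDerivAt_val_apply_along (g := g) hcompat (hS t) (hS t)
      have h' : g.val (γ t) (covariantDerivAlong g.leviCivita γ S t) (S t) +
          g.val (γ t) (S t) (covariantDerivAlong g.leviCivita γ S t) = 2 * aF t := by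
        rw [g.symm (γ t) (S t) (covariantDerivAlong g.leviCivita γ S t)]
        show aF t + aF t = 2 * aF t
        ring
      rw [h'] at h
      exact h
    -- `γ t = F (t u)` and `S t = dF_{tu}(tw)` for `|t| < r₁`
    have hu0 : u + (0 : ℝ) • w = u := by rw [zero_smul, add_zero]
    have hγt : ∀ t : ℝ, |t| < r₁ → γ t = F (t • (show E from u)) := by
      intro t ht
      show maximalGeodesic g.leviCivita p (u + (0 : ℝ) • w) t = F (t • (show E from u))
      rw [hu0, ← expMap_smul hc p u t]
      exact riemannianExpMap_eq_of_radial hn hg hc hr₁ hFs hF0 hdF0 hinj hdF hrad hgauss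
        (hBt u hu t ht)
    have hSt : ∀ t : ℝ, |t| < r₁ →
        S t = mfderiv 𝓘(ℝ, E) I F (t • (show E from u)) (t • (show E from w)) := by
      intro t ht
      have h1 := velocity_geodesicVariation_eq_mfderiv_expMap hc p u w t
      have h3 := mfderiv_riemannianExpMap_eq_of_radial hn hg hc hr₁ hFs hF0 hdF0 hinj hdF hrad
        hgauss (hBt u hu t ht)
      show velocity I (fun s : ℝ ↦ maximalGeodesic g.leviCivita p (u + s • w) t) 0 = _
      rw [h1]
      exact DFunLike.congr_fun h3 (t • (show E from w))
    have hfeq : ∀ t : ℝ, |t| < r₁ → fF t =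
        g.val (F (t • (show E from u))) (mfderiv 𝓘(ℝ, E) I F (t • (show E from u)) (t • (show E from w)))
          (mfderiv 𝓘(ℝ, E) I F (t • (show E from u)) (t • (show E from w))) := by
      intro t ht
      show g.val (γ t) (S t) (S t) = _
      rw [hSt t ht]
      exact val_eq_of_eq_basePoint (g := g) (hγt t ht) _ _
    -- the derivative of `f` at `R`
    have hnhd : {t : ℝ | |t| < r₁} ∈ 𝓝 R := (isOpen_lt continuous_abs continuous_const).mem_nhds hRabs
    have hev : (fun t : ℝ ↦ g.val (F (t • (show E from u)))
        (mfderiv 𝓘(ℝ, E) I F (t • (show E from u)) (t • (show E from w)))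
        (mfderiv 𝓘(ℝ, E) I F (t • (show E from u)) (t • (show E from w)))) =ᶠ[𝓝 R] fF := by
      filter_upwards [hnhd] with t ht
      exact (hfeq t ht).symm
    have hderiv : deriv (fun t : ℝ ↦ g.val (F (t • (show E from u)))
        (mfderiv 𝓘(ℝ, E) I F (t • (show E from u)) (t • (show E from w)))
        (mfderiv 𝓘(ℝ, E) I F (t • (show E from u)) (t • (show E from w)))) R = 2 * aF R := by
      rw [hev.deriv_eq, (hf R).deriv]
    have hex := hexit u w hu
    rw [hderiv, ← hfeq R hRabs] at hex
    show -(lam * fF R) ≤ aF R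
    linarith [hex]

end Radial

end Literature.Geometry.Riemannian

end
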